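import Summits.Ventures.PercRepro.SevenThreeTripleWitnessB
import Summits.Ventures.PercRepro.SevenThreeWitnessStructureB
import Summits.Ventures.PercRepro.SevenThreeSmallCells

/-!
# PercRepro — the `(7,3)` cell, (R6) part (c): the witness sum of one `B′` (night-3, gen 4)

`G` a plane, `B ⊆ G` of rank `3` (`b = |B|`, `Λ = Λ(B)`), `K ⊆ E ∖ G`.  The witnesses `B ∪ X`, `X ∈ W(K)` (the
`1`-, `2`- and `3`-subsets of `K`), supply `G` with `Σ_X f(G, B ∪ X) / D(B ∪ X)`; by the share bounds (singles:
`D_single_le`; pairs: `D_pair_le_generic` / `D_pair_le` by `ρ(G ∪ X) = 5 / 4`; triples: `D_triple_le_generic` /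
`D_triple_le_rank_five` / `D_triple_le` by `ρ(G ∪ X) = 6 / 5 / 4`) and the counts `p` (parallel pairs), `q` (rank-`4`
triples), `r` (rank-`≤ 5` triples) of the witness structure,
`Σ ≥ |K|·w₁ + (C(|K|,2) − p)·w₂ + p·w₂⁻ + (C(|K|,3) − r)·w₃ + (r − q)·w₃⁻ + q·w₃⁼` (`witness_sum_ge`).  With
`witness_structure_six / five` and the free case this is `Cells.vOneL b Λ` (`|K| = 6`), `Cells.vTwoL b Λ` (`|K| = 5`),
`Cells.vThreeL b Λ` (`|K| = 4`): `witness_sum_six / five / four`.  Axioms: standard.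
-/

namespace PercRepro

namespace SevenThree

open Finset ThmH SixThree

variable {α : Type*} [DecidableEq α] {M : Matroid α} [M.Finite]

/-- The witness family of `K`: its nonempty subsets with at most three points. -/
def W (K : Finset α) : Finset (Finset α) := K.powersetCard 1 ∪ K.powersetCard 2 ∪ K.powersetCard 3

omit [M.Finite] in
/-- `ρ(B ∪ X) = ρ(G ∪ X)` when `G = cl(B)`. -/
theorem eRk_union_eq_of_closure {G B X : Finset α} (hcl : M.closure (B : Set α) = (G : Set α)) :
    M.eRk ((B ∪ X : Finset α) : Set α) = M.eRk ((G ∪ X : Finset α) : Set α) := by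
  rw [Finset.coe_union, Finset.coe_union, ← hcl, M.eRk_union_closure_left_eq]

omit [DecidableEq α] [M.Finite] in
/-- Disjointness of the three layers of `W K`. -/
theorem disjoint_powersetCard_of_ne (K : Finset α) {i j : ℕ} (h : i ≠ j) :
    Disjoint (K.powersetCard i) (K.powersetCard j) := by
  rw [Finset.disjoint_left]
  intro X hi hj
  rw [Finset.mem_powersetCard] at hi hj
  exact h (hi.2.symm.trans hj.2)

/-- `ρ(G ∪ X) ≥ 4` for a nonempty `X ⊆ E ∖ G`. -/
theorem four_le_eRk_union {G X : Finset α} (hG : G ∈ planes M) (hX : X ⊆ gr M) (hXG : Disjoint X G)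
    (hne : X.Nonempty) : (4 : ℕ∞) ≤ M.eRk ((G ∪ X : Finset α) : Set α) := by
  obtain ⟨x, hx⟩ := hne
  rw [← eRk_union_singleton_eq_four hG (hX hx) (Finset.disjoint_left.1 hXG hx)]
  apply M.eRk_mono
  rw [Finset.coe_subset]
  exact Finset.union_subset_union (Finset.Subset.refl G) (Finset.singleton_subset_iff.2 hx)

/-- **The witness sum of `B` over `W(K)`, from the structure counts.** -/
theorem witness_sum_ge (hs : Simple M) {G B K : Finset α} (hG : G ∈ planes M) (hB : B ⊆ G)
    (hrB : M.eRk (B : Set α) = 3) (hK : K ⊆ gr M) (hKG : Disjoint K G) {p q r : ℕ}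
    (hp : ((K.powersetCard 2).filter (fun X => M.eRk ((G ∪ X : Finset α) : Set α) = 4)).card ≤ p)
    (hq : ((K.powersetCard 3).filter (fun X => M.eRk ((G ∪ X : Finset α) : Set α) = 4)).card ≤ q)
    (hr : ((K.powersetCard 3).filter (fun X => M.eRk ((G ∪ X : Finset α) : Set α) ≤ 5)).card ≤ r) :
    (K.card : ℚ) * (Cells.T B.card / (Cells.T B.card + Lam M B)) +
      ((K.card.choose 2 : ℚ) - p) * (Cells.T B.card / (Cells.T B.card + 2 * Lam M B + B.card)) +
      p * (Cells.T B.card / (Cells.T B.card + 6 * Lam M B + B.card)) +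
      ((K.card.choose 3 : ℚ) - r) * (Cells.T B.card / (Cells.T B.card + 3 * Lam M B + 3 * B.card + 1)) +
      ((r : ℚ) - q) * (Cells.T B.card / (Cells.T B.card + 7 * Lam M B + 6 * B.card + 1)) +
      q * (Cells.T B.card / (Cells.T B.card + 36 * Lam M B + 6 * B.card + 1)) ≤
    ∑ X ∈ W K, fRule M G (B ∪ X) / D M (B ∪ X) := by
  have hBg : B ⊆ gr M := hB.trans (mem_planes.1 hG).1
  have hcl : M.closure (B : Set α) = (G : Set α) := closure_eq_of_subset_plane hG hB hrB
  have hΛ : 0 ≤ Lam M B := Finset.sum_nonneg (fun L _ => by positivity)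
  set T := Cells.T B.card with hT
  have hTpos : 0 < T := by rw [hT, Cells.T]; positivity
  have hb0 : (0 : ℚ) ≤ B.card := by positivity
  -- the six shares and their monotonicity
  set w₁ := T / (T + Lam M B) with hw₁
  set w₂ := T / (T + 2 * Lam M B + B.card) with hw₂
  set w₂m := T / (T + 6 * Lam M B + B.card) with hw₂m
  set w₃ := T / (T + 3 * Lam M B + 3 * B.card + 1) with hw₃
  set w₃m := T / (T + 7 * Lam M B + 6 * B.card + 1) with hw₃m
  set w₃e := T / (T + 36 * Lam M B + 6 * B.card + 1) with hw₃e
  have hw₂le : w₂m ≤ w₂ := div_le_div_of_nonneg_left hTpos.le (by positivity) (by linarith)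
  have hw₃le : w₃m ≤ w₃ := div_le_div_of_nonneg_left hTpos.le (by positivity) (by linarith)
  have hw₃le' : w₃e ≤ w₃m := div_le_div_of_nonneg_left hTpos.le (by positivity) (by linarith)
  -- the sum over `W K` splits into the three layers
  have hdisj12 : Disjoint (K.powersetCard 1) (K.powersetCard 2) := disjoint_powersetCard_of_ne K (by decide)
  have hdisj3 : Disjoint (K.powersetCard 1 ∪ K.powersetCard 2) (K.powersetCard 3) := by
    rw [Finset.disjoint_union_left]
    exact ⟨disjoint_powersetCard_of_ne K (by decide), disjoint_powersetCard_of_ne K (by decide)⟩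
  have hsplit : ∑ X ∈ W K, fRule M G (B ∪ X) / D M (B ∪ X) =
      ∑ X ∈ K.powersetCard 1, fRule M G (B ∪ X) / D M (B ∪ X) +
      ∑ X ∈ K.powersetCard 2, fRule M G (B ∪ X) / D M (B ∪ X) +
      ∑ X ∈ K.powersetCard 3, fRule M G (B ∪ X) / D M (B ∪ X) := by
    rw [W, Finset.sum_union hdisj3, Finset.sum_union hdisj12]
  -- facts about a witness `X ⊆ K`
  have hXg : ∀ X ∈ K.powerset, X ⊆ gr M := fun X hX => (Finset.mem_powerset.1 hX).trans hK
  have hXG : ∀ X ∈ K.powerset, Disjoint X G := fun X hX =>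
    Finset.disjoint_of_subset_left (Finset.mem_powerset.1 hX) hKG
  -- singles
  have h1 : (K.card : ℚ) * w₁ ≤ ∑ X ∈ K.powersetCard 1, fRule M G (B ∪ X) / D M (B ∪ X) := by
    have hpt : ∀ X ∈ K.powersetCard 1, w₁ ≤ fRule M G (B ∪ X) / D M (B ∪ X) := by
      intro X hX
      rw [Finset.mem_powersetCard] at hX
      obtain ⟨x, rfl⟩ := Finset.card_eq_one.1 hX.2
      have hx : x ∈ gr M := hK (hX.1 (Finset.mem_singleton_self x))
      have hxG : x ∉ G := Finset.disjoint_left.1 hKG (hX.1 (Finset.mem_singleton_self x))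
      have hD := D_single_le hs hG hB hrB hx hxG
      have hXG' : Disjoint ({x} : Finset α) G := Finset.disjoint_singleton_left.2 hxG
      have := share_ge_of_D_le hG hB hrB hXG' (D₀ := (6 : ℚ) ^ (B.card - 3) + Lam M B)
        (by rw [Finset.union_comm, Finset.singleton_union]; exact hD)
      rw [hw₁, hT, Cells.T]
      exact this
    calc (K.card : ℚ) * w₁ = ∑ _X ∈ K.powersetCard 1, w₁ := by
          rw [Finset.sum_const, Finset.card_powersetCard, Nat.choose_one_right, nsmul_eq_mul]
      _ ≤ _ := Finset.sum_le_sum hpt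
  -- pairs
  have h2 : (K.card.choose 2 : ℚ) * w₂ - (w₂ - w₂m) * p ≤
      ∑ X ∈ K.powersetCard 2, fRule M G (B ∪ X) / D M (B ∪ X) := by
    have hpt : ∀ X ∈ K.powersetCard 2,
        w₂ - (w₂ - w₂m) * (if M.eRk ((G ∪ X : Finset α) : Set α) = 4 then (1 : ℚ) else 0) ≤
          fRule M G (B ∪ X) / D M (B ∪ X) := by
      intro X hX
      have hXK : X ∈ K.powerset := Finset.mem_powerset.2 (Finset.mem_powersetCard.1 hX).1
      have hX2 := (Finset.mem_powersetCard.1 hX).2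
      obtain ⟨x, x', hxx', rfl⟩ := Finset.card_eq_two.1 hX2
      have hx : x ∈ gr M := hXg _ hXK (Finset.mem_insert_self x {x'})
      have hx' : x' ∈ gr M := hXg _ hXK (Finset.mem_insert_of_mem (Finset.mem_singleton_self x'))
      have hxG : x ∉ G := Finset.disjoint_left.1 (hXG _ hXK) (Finset.mem_insert_self x {x'})
      have hx'G : x' ∉ G := Finset.disjoint_left.1 (hXG _ hXK) (Finset.mem_insert_of_mem (Finset.mem_singleton_self x'))
      have hform : B ∪ {x, x'} = insert x (insert x' B) := by
        ext z; simp only [Finset.mem_union, Finset.mem_insert, Finset.mem_singleton]; tauto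
      have hrank : M.eRk ((B ∪ {x, x'} : Finset α) : Set α) = M.eRk ((G ∪ {x, x'} : Finset α) : Set α) :=
        eRk_union_eq_of_closure hcl
      by_cases h4 : M.eRk ((G ∪ {x, x'} : Finset α) : Set α) = 4
      · rw [if_pos h4]
        have hD := D_pair_le hs hG hB hrB hx hx' hxx' hxG hx'G
        rw [← hform] at hD
        have := share_ge_of_D_le hG hB hrB (hXG _ hXK) hD
        rw [hw₂m, hT, Cells.T] at *
        linarith
      · rw [if_neg h4]
        -- the rank is `5`
        have hr5 : M.eRk ((insert x (insert x' B) : Finset α) : Set α) = 5 := by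
          rw [← hform, hrank]
          have hle : M.eRk ((G ∪ {x, x'} : Finset α) : Set α) ≤ 5 := by
            have := eRk_union_le_eRk_add_card (M := M) G {x, x'}
            rw [(mem_planes.1 hG).2.2, Finset.card_pair hxx'] at this
            exact this.trans (by norm_num)
          have hge := four_le_eRk_union hG (hXg _ hXK) (hXG _ hXK) ⟨x, Finset.mem_insert_self x {x'}⟩
          obtain ⟨k, hk, -⟩ := eRk_eq_nat M (G ∪ {x, x'})
          rw [hk] at hle hge h4 ⊢
          have hk5 : k ≤ 5 := by exact_mod_cast hle
          have hk4 : 4 ≤ k := by exact_mod_cast hge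
          have hk4' : k ≠ 4 := fun h => h4 (by rw [h]; rfl)
          exact_mod_cast (show k = 5 by omega)
        have hD := D_pair_le_generic hs hG hB hrB hx hx' hxx' hxG hx'G hr5
        rw [← hform] at hD
        have := share_ge_of_D_le hG hB hrB (hXG _ hXK) hD
        rw [hw₂, hT, Cells.T] at *
        linarith
    calc (K.card.choose 2 : ℚ) * w₂ - (w₂ - w₂m) * p
        ≤ (K.card.choose 2 : ℚ) * w₂ - (w₂ - w₂m) *
            (((K.powersetCard 2).filter (fun X => M.eRk ((G ∪ X : Finset α) : Set α) = 4)).card : ℚ) := by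
          have hc : (((K.powersetCard 2).filter (fun X => M.eRk ((G ∪ X : Finset α) : Set α) = 4)).card : ℚ) ≤ p := by
            exact_mod_cast hp
          nlinarith [sub_nonneg.2 hw₂le]
      _ = ∑ X ∈ K.powersetCard 2,
            (w₂ - (w₂ - w₂m) * (if M.eRk ((G ∪ X : Finset α) : Set α) = 4 then (1 : ℚ) else 0)) := by
          rw [Finset.sum_sub_distrib, Finset.sum_const, Finset.card_powersetCard, nsmul_eq_mul,
            ← Finset.mul_sum, Finset.sum_boole]
      _ ≤ _ := Finset.sum_le_sum hpt
  -- triples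
  have h3 : (K.card.choose 3 : ℚ) * w₃ - (w₃ - w₃m) * r - (w₃m - w₃e) * q ≤
      ∑ X ∈ K.powersetCard 3, fRule M G (B ∪ X) / D M (B ∪ X) := by
    have hpt : ∀ X ∈ K.powersetCard 3,
        w₃ - (w₃ - w₃m) * (if M.eRk ((G ∪ X : Finset α) : Set α) ≤ 5 then (1 : ℚ) else 0) -
            (w₃m - w₃e) * (if M.eRk ((G ∪ X : Finset α) : Set α) = 4 then (1 : ℚ) else 0) ≤
          fRule M G (B ∪ X) / D M (B ∪ X) := by
      intro X hX
      have hXK : X ∈ K.powerset := Finset.mem_powerset.2 (Finset.mem_powersetCard.1 hX).1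
      have hX3 := (Finset.mem_powersetCard.1 hX).2
      have hrank : M.eRk ((B ∪ X : Finset α) : Set α) = M.eRk ((G ∪ X : Finset α) : Set α) :=
        eRk_union_eq_of_closure hcl
      have hle : M.eRk ((G ∪ X : Finset α) : Set α) ≤ 6 := by
        have := eRk_union_le_eRk_add_card (M := M) G X
        rw [(mem_planes.1 hG).2.2, hX3] at this
        exact this.trans (by norm_num)
      have hge := four_le_eRk_union hG (hXg _ hXK) (hXG _ hXK) (Finset.card_pos.1 (by omega))
      obtain ⟨k, hk, -⟩ := eRk_eq_nat M (G ∪ X)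
      have hk6 : k ≤ 6 := by rw [hk] at hle; exact_mod_cast hle
      have hk4 : 4 ≤ k := by rw [hk] at hge; exact_mod_cast hge
      rcases (show k = 4 ∨ k = 5 ∨ k = 6 by omega) with h | h | h
      · rw [h] at hk
        have hc1 : M.eRk ((G ∪ X : Finset α) : Set α) ≤ 5 := by
          rw [hk]; exact_mod_cast (show (4 : ℕ) ≤ 5 by norm_num)
        have hc2 : M.eRk ((G ∪ X : Finset α) : Set α) = 4 := by rw [hk]; rfl
        rw [if_pos hc1, if_pos hc2]
        have hD := D_triple_le hs hG hB hrB (hXg _ hXK) (hXG _ hXK) hX3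
        have hD' : D M (B ∪ X) ≤ (6 : ℚ) ^ (B.card - 3) + 36 * Lam M B + 6 * B.card + 1 := by linarith
        have := share_ge_of_D_le hG hB hrB (hXG _ hXK) hD'
        rw [hw₃e, hT, Cells.T] at *
        linarith
      · rw [h] at hk
        have hc1 : M.eRk ((G ∪ X : Finset α) : Set α) ≤ 5 := by
          rw [hk]; exact_mod_cast (show (5 : ℕ) ≤ 5 by norm_num)
        have hc2 : ¬ M.eRk ((G ∪ X : Finset α) : Set α) = 4 := by
          rw [hk]; exact_mod_cast (show (5 : ℕ) ≠ 4 by norm_num)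
        rw [if_pos hc1, if_neg hc2]
        have hr5 : (5 : ℕ∞) ≤ M.eRk ((B ∪ X : Finset α) : Set α) := by rw [hrank, hk]; rfl
        have hD := D_triple_le_rank_five hs hG hB hrB (hXg _ hXK) (hXG _ hXK) hX3 hr5
        have hD' : D M (B ∪ X) ≤ (6 : ℚ) ^ (B.card - 3) + 7 * Lam M B + 6 * B.card + 1 := by linarith
        have := share_ge_of_D_le hG hB hrB (hXG _ hXK) hD'
        rw [hw₃m, hT, Cells.T] at *
        linarith
      · rw [h] at hk
        have hc1 : ¬ M.eRk ((G ∪ X : Finset α) : Set α) ≤ 5 := by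
          rw [hk]; exact_mod_cast (show ¬ (6 : ℕ) ≤ 5 by norm_num)
        have hc2 : ¬ M.eRk ((G ∪ X : Finset α) : Set α) = 4 := by
          rw [hk]; exact_mod_cast (show (6 : ℕ) ≠ 4 by norm_num)
        rw [if_neg hc1, if_neg hc2]
        have hr6 : M.eRk ((B ∪ X : Finset α) : Set α) = 6 := by rw [hrank, hk]; rfl
        have hD := D_triple_le_generic hs hG hB hrB (hXg _ hXK) (hXG _ hXK) hX3 hr6
        have hD' : D M (B ∪ X) ≤ (6 : ℚ) ^ (B.card - 3) + 3 * Lam M B + 3 * B.card + 1 := by linarith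
        have := share_ge_of_D_le hG hB hrB (hXG _ hXK) hD'
        rw [hw₃, hT, Cells.T] at *
        linarith
    calc (K.card.choose 3 : ℚ) * w₃ - (w₃ - w₃m) * r - (w₃m - w₃e) * q
        ≤ (K.card.choose 3 : ℚ) * w₃ -
            (w₃ - w₃m) * (((K.powersetCard 3).filter (fun X => M.eRk ((G ∪ X : Finset α) : Set α) ≤ 5)).card : ℚ) -
            (w₃m - w₃e) * (((K.powersetCard 3).filter (fun X => M.eRk ((G ∪ X : Finset α) : Set α) = 4)).card : ℚ) := by
          have hc1 : (((K.powersetCard 3).filter (fun X => M.eRk ((G ∪ X : Finset α) : Set α) ≤ 5)).card : ℚ) ≤ r := by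
            exact_mod_cast hr
          have hc2 : (((K.powersetCard 3).filter (fun X => M.eRk ((G ∪ X : Finset α) : Set α) = 4)).card : ℚ) ≤ q := by
            exact_mod_cast hq
          nlinarith [sub_nonneg.2 hw₃le, sub_nonneg.2 hw₃le']
      _ = ∑ X ∈ K.powersetCard 3,
            (w₃ - (w₃ - w₃m) * (if M.eRk ((G ∪ X : Finset α) : Set α) ≤ 5 then (1 : ℚ) else 0) -
              (w₃m - w₃e) * (if M.eRk ((G ∪ X : Finset α) : Set α) = 4 then (1 : ℚ) else 0)) := by
          rw [Finset.sum_sub_distrib, Finset.sum_sub_distrib, Finset.sum_const, Finset.card_powersetCard,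
            nsmul_eq_mul, ← Finset.mul_sum, ← Finset.mul_sum, Finset.sum_boole, Finset.sum_boole]
      _ ≤ _ := Finset.sum_le_sum hpt
  rw [hsplit]
  have hp' : (0 : ℚ) ≤ p := by positivity
  have hq' : (0 : ℚ) ≤ q := by positivity
  have hr' : (0 : ℚ) ≤ r := by positivity
  linarith

/-- **`t = 1`**: with `|K| = 6` and `ρ(G ∪ K) = 7`, a rank-`3` subset `B ⊆ G` supplies at least `v₁(|B|, Λ(B))`. -/
theorem witness_sum_six (hs : Simple M) {G B K : Finset α} (hG : G ∈ planes M) (hB : B ⊆ G)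
    (hrB : M.eRk (B : Set α) = 3) (hK : K ⊆ gr M) (hKG : Disjoint K G)
    (hr : M.eRk ((G ∪ K : Finset α) : Set α) = 7) (hK6 : K.card = 6) :
    Cells.vOneL B.card (Lam M B) ≤ ∑ X ∈ W K, fRule M G (B ∪ X) / D M (B ∪ X) := by
  obtain ⟨hp, hq, hr'⟩ := witness_structure_six hG hK hKG hr hK6
  have h := witness_sum_ge hs hG hB hrB hK hKG hp hq hr'
  rw [hK6] at h
  have h15 : ((Nat.choose 6 2 : ℕ) : ℚ) = 15 := by norm_num [Nat.choose]
  have h20 : ((Nat.choose 6 3 : ℕ) : ℚ) = 20 := by norm_num [Nat.choose]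
  rw [h15, h20] at h
  push_cast at h
  unfold Cells.vOneL
  linarith

/-- **`t = 2`**: with `|K| = 5`, a rank-`3` subset `B ⊆ G` supplies at least `v₂(|B|, Λ(B))`. -/
theorem witness_sum_five (hs : Simple M) {G B K : Finset α} (hG : G ∈ planes M) (hB : B ⊆ G)
    (hrB : M.eRk (B : Set α) = 3) (hK : K ⊆ gr M) (hKG : Disjoint K G)
    (hr : M.eRk ((G ∪ K : Finset α) : Set α) = 7) (hK5 : K.card = 5) :
    Cells.vTwoL B.card (Lam M B) ≤ ∑ X ∈ W K, fRule M G (B ∪ X) / D M (B ∪ X) := by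
  obtain ⟨hp, hq, hr'⟩ := witness_structure_five hG hK hKG hr hK5
  have h := witness_sum_ge hs hG hB hrB hK hKG hp (le_of_eq hq) hr'
  rw [hK5] at h
  have h10 : ((Nat.choose 5 2 : ℕ) : ℚ) = 10 := by norm_num [Nat.choose]
  have h10' : ((Nat.choose 5 3 : ℕ) : ℚ) = 10 := by norm_num [Nat.choose]
  rw [h10, h10'] at h
  push_cast at h
  unfold Cells.vTwoL
  linarith

/-- **`t = 3`**: with `|K| = 4` (the free case), a rank-`3` subset `B ⊆ G` supplies at least `v₃(|B|, Λ(B))`. -/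
theorem witness_sum_four (hs : Simple M) {G B K : Finset α} (hG : G ∈ planes M) (hB : B ⊆ G)
    (hrB : M.eRk (B : Set α) = 3) (hK : K ⊆ gr M) (hKG : Disjoint K G)
    (hr : M.eRk ((G ∪ K : Finset α) : Set α) = 7) (hK4 : K.card = 4) :
    Cells.vThreeL B.card (Lam M B) ≤ ∑ X ∈ W K, fRule M G (B ∪ X) / D M (B ∪ X) := by
  have hG3 := (mem_planes.1 hG).2.2
  have hfree : ∀ X ∈ K.powerset, M.eRk ((G ∪ X : Finset α) : Set α) = ((3 + X.card : ℕ) : ℕ∞) :=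
    fun X hX => eRk_union_eq_of_free hG3 hK4 hr (Finset.mem_powerset.1 hX)
  have hp : ((K.powersetCard 2).filter (fun X => M.eRk ((G ∪ X : Finset α) : Set α) = 4)).card ≤ 0 := by
    rw [Finset.card_eq_zero.2 (Finset.filter_eq_empty_iff.2 (fun X hX h => ?_))]
    have hX := Finset.mem_powersetCard.1 hX
    rw [hfree X (Finset.mem_powerset.2 hX.1), hX.2] at h
    exact absurd h (by decide)
  have hq : ((K.powersetCard 3).filter (fun X => M.eRk ((G ∪ X : Finset α) : Set α) = 4)).card ≤ 0 := by
    rw [Finset.card_eq_zero.2 (Finset.filter_eq_empty_iff.2 (fun X hX h => ?_))]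
    have hX := Finset.mem_powersetCard.1 hX
    rw [hfree X (Finset.mem_powerset.2 hX.1), hX.2] at h
    exact absurd h (by decide)
  have hr' : ((K.powersetCard 3).filter (fun X => M.eRk ((G ∪ X : Finset α) : Set α) ≤ 5)).card ≤ 0 := by
    rw [Finset.card_eq_zero.2 (Finset.filter_eq_empty_iff.2 (fun X hX h => ?_))]
    have hX := Finset.mem_powersetCard.1 hX
    rw [hfree X (Finset.mem_powerset.2 hX.1), hX.2] at h
    exact absurd h (by decide)
  have h := witness_sum_ge hs hG hB hrB hK hKG hp hq hr'
  rw [hK4] at h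
  have h6 : ((Nat.choose 4 2 : ℕ) : ℚ) = 6 := by norm_num [Nat.choose]
  have h4 : ((Nat.choose 4 3 : ℕ) : ℚ) = 4 := by norm_num [Nat.choose]
  rw [h6, h4] at h
  push_cast at h
  unfold Cells.vThreeL
  linarith

end SevenThree

end PercRepro
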